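import Summits.AtomisticToContinuum.HydrodynamicLimit.Theses.LambertianContactSwap
import Summits.AtomisticToContinuum.HydrodynamicLimit.Theorems.JParityClosureParityInBandSmoothTest
import Summits.AtomisticToContinuum.HydrodynamicLimit.Theorems.JParityClosureParityInBandEnergyTight
import Summits.AtomisticToContinuum.HydrodynamicLimit.Theorems.OneFlightGossipEngineUniformLocalGibbsConcentration
import Summits.AtomisticToContinuum.HydrodynamicLimit.Theorems.OneFlightGossipEngineUniformLocalGibbsConcentrationFields
import Summits.AtomisticToContinuum.HydrodynamicLimit.Theorems.LambertianContactSwapSwapGapFieldConcentrationOfLD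
import Summits.AtomisticToContinuum.HydrodynamicLimit.Theorems.LambertianContactSwapSwapGapEntropyTransfer
import Literature.MathematicalPhysics.KineticTheory.LambertianHardSphereFlow
import Literature.MathematicalPhysics.KineticTheory.HardSphereEulerProofs
import HarnessLib

/-!
# `SwapGap` (stmt-AtomisticToContinuum-11850), line `Sketch`, stub T7: smooth test functions suffice on the `Λ`-side

Helper file (`--supports stmt-AtomisticToContinuum-11850`) of line `Sketch` (card
`entropy-relative-to-lambertian-law`) for the crux
`Summit.AtomisticToContinuum.HydrodynamicLimit.Theses.LambertianContactSwap.SwapGap`, registered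
interface stub `stub_fieldConcentration_of_smoothTest` (T7) of the lead's skeleton v9: the research
stub S2 of the line (speed-`N` self-averaging of every bounded `1`-Lipschitz statistic `F` of the
`χ`-tested field triple of the Lambertian gas `Λ_t` about its own mean, for CONTINUOUS `χ`) follows
from its restriction to test functions with smooth periodic lift (`Torus.IsSmooth χ`).

Proof. Fix profiles; `σ₀ := min (1/2) (min σ₁ σ₂)` with `σ₁` from the smooth-test hypothesis and
`σ₂ := min 1 (η₀ ∫a₀ / sup a₀)` from the density guard of the `η₀`-uniform exponential law of large
numbers `uniformLocalGibbsConcentration_proof` (stmt-14445). ENERGY EVENT: with `χ ≡ 1` at level `1`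
the latter gives `P_N{1 < |e_1 − Ē|} ≤ C₁ e^{-(N+1)/C₁}` (`e_1` = kinetic energy per particle,
`Ē = ∫ E(ρ₀, u₀, θ₀)`), hence the same bound for the cylinder `B_N := {1 < |e_1(p.1) − Ē|}` under
`P_N ⊗ γ^ℕ`; off `B_N`, `e_1(Λ_t p) ≤ e_1(p.1) ≤ K := |Ē| + 1` (`configEnergy_lambertFlow_le`).
APPROXIMATION: a smooth `ψ` with `‖ψ − χ‖_∞ ≤ δ' := δ / (8 (1 + K))` (`exists_isSmooth_near`); by
`empiricalFields_sub_le` and `Prod.dist_eq`, off `B_N` the two field triples are `δ'(1 + K) = δ/8`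
close in the sup distance, so `|F(fld_χ Λ_t) − F(fld_ψ Λ_t)| ≤ δ/8`. BOOKKEEPING
(`expConc_sub_integral_of_near`): the two means differ by at most `δ/8 + 2 C₁ e^{-(N+1)/C₁} ≤ δ/4`
for `N ≥ N₀`, so `{δ < |G − ∫G|} ⊆ B_N ∪ {δ/2 < |G' − ∫G'|}`; the two exponential bounds add up
(`UniformLGC.ofReal_Kexp_add_le`) and the finitely many `N < N₀` are absorbed into the constant
(`≥ max(N₀, 3)`, as in `expConc_sub_integral_of_expConc_sub_const`).

prover-line-stmt-AtomisticToContinuum-11850-c5-0 (wave 6 worker), cycle 6.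
-/

noncomputable section

open MeasureTheory Filter Set Topology
open scoped ENNReal

namespace Summit.AtomisticToContinuum.HydrodynamicLimit.Theorems

open Literature.Analysis.FluidPDE Literature.MathematicalPhysics.KineticTheory
open Summit.AtomisticToContinuum.HydrodynamicLimit.Theses.LambertianContactSwap

/-! ### Abstract bookkeeping: concentration transfers between exponentially close statistics -/

/-- **Exponential concentration around the mean passes to a nearby statistic.** On probability
spaces `(Ω_N, μ_N)`, let `G_N, G'_N` be measurable with `|G_N|, |G'_N| ≤ 1`, and let `B_N` be
measurable events with `μ_N(B_N) ≤ C₁ e^{-(N+1)/C₁}` off which `|G_N − G'_N| ≤ δ/8`. If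
`μ_N{δ/2 < |G'_N − ∫ G'_N dμ_N|} ≤ C₂ e^{-(N+1)/C₂}` for all `N`, then for some `C > 0`,
`μ_N{δ < |G_N − ∫ G_N dμ_N|} ≤ C e^{-(N+1)/C}` for all `N`. Proof:
`|∫ G_N − ∫ G'_N| ≤ δ/8 + 2 μ_N(B_N) ≤ δ/8 + 2 C₁ e^{-(N+1)/C₁} ≤ δ/4` for `N ≥ N₀`, so then
`{δ < |G_N − mean|} ⊆ B_N ∪ {δ/2 < |G'_N − mean'|}`; the two rates add up to `C₁ + C₂`
(`UniformLGC.ofReal_Kexp_add_le`) and the finitely many `N < N₀` are absorbed by taking the constant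
`≥ max(N₀, 3)` (adapted from `expConc_sub_integral_of_expConc_sub_const`). [folklore] -/
theorem expConc_sub_integral_of_near {Ω : ℕ → Type*} [∀ N, MeasurableSpace (Ω N)]
    (μ : (N : ℕ) → Measure (Ω N)) (hμ : ∀ N, IsProbabilityMeasure (μ N))
    (G G' : (N : ℕ) → Ω N → ℝ) (hG : ∀ N, Measurable (G N)) (hG' : ∀ N, Measurable (G' N))
    (hGb : ∀ N x, |G N x| ≤ 1) (hG'b : ∀ N x, |G' N x| ≤ 1)
    (B : (N : ℕ) → Set (Ω N)) (hB : ∀ N, MeasurableSet (B N)) {δ : ℝ} (hδ : 0 < δ)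
    (hnear : ∀ N x, x ∉ B N → |G N x - G' N x| ≤ δ / 8)
    {C₁ : ℝ} (hC₁ : 0 < C₁)
    (hBμ : ∀ N, μ N (B N) ≤ ENNReal.ofReal (C₁ * Real.exp (-(C₁⁻¹ * ((N : ℝ) + 1)))))
    {C₂ : ℝ} (hC₂ : 0 < C₂)
    (hG'c : ∀ N, μ N {x | δ / 2 < |G' N x - ∫ y, G' N y ∂μ N|} ≤
      ENNReal.ofReal (C₂ * Real.exp (-(C₂⁻¹ * ((N : ℝ) + 1))))) :
    ∃ C : ℝ, 0 < C ∧ ∀ N : ℕ, μ N {x | δ < |G N x - ∫ y, G N y ∂μ N|} ≤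
      ENNReal.ofReal (C * Real.exp (-(C⁻¹ * ((N : ℝ) + 1)))) := by
  set r : ℕ → ℝ := fun N => C₁ * Real.exp (-(C₁⁻¹ * ((N : ℝ) + 1))) with hr
  have hr0 : ∀ N, 0 ≤ r N := fun N => by positivity
  -- the two means are close
  have hmean : ∀ N, |(∫ y, G N y ∂μ N) - ∫ y, G' N y ∂μ N| ≤ δ / 8 + 2 * r N := by
    intro N
    haveI := hμ N
    have hμB : (μ N).real (B N) ≤ r N := ENNReal.toReal_le_of_le_ofReal (hr0 N) (hBμ N)
    have hGi : Integrable (G N) (μ N) :=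
      Integrable.of_bound (hG N).aestronglyMeasurable 1 (ae_of_all _ fun x => by
        rw [Real.norm_eq_abs]; exact hGb N x)
    have hG'i : Integrable (G' N) (μ N) :=
      Integrable.of_bound (hG' N).aestronglyMeasurable 1 (ae_of_all _ fun x => by
        rw [Real.norm_eq_abs]; exact hG'b N x)
    have hpt : ∀ x, |G N x - G' N x| ≤ (B N).indicator (fun _ => (2 : ℝ)) x + δ / 8 := by
      intro x
      by_cases hx : x ∈ B N
      · rw [Set.indicator_of_mem hx]
        have h3 : |G N x - G' N x| ≤ |G N x| + |G' N x| := abs_sub _ _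
        linarith [hGb N x, hG'b N x]
      · rw [Set.indicator_of_notMem hx, zero_add]
        exact hnear N x hx
    have hint : (∫ y, G N y ∂μ N) - ∫ y, G' N y ∂μ N = ∫ y, (G N y - G' N y) ∂μ N :=
      (integral_sub hGi hG'i).symm
    have hgi : Integrable (fun x => (B N).indicator (fun _ => (2 : ℝ)) x + δ / 8) (μ N) :=
      ((integrable_const (2 : ℝ)).indicator (hB N)).add (integrable_const _)
    calc |(∫ y, G N y ∂μ N) - ∫ y, G' N y ∂μ N| = |∫ y, (G N y - G' N y) ∂μ N| := by rw [hint]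
      _ ≤ ∫ y, |G N y - G' N y| ∂μ N := abs_integral_le_integral_abs
      _ ≤ ∫ y, ((B N).indicator (fun _ => (2 : ℝ)) y + δ / 8) ∂μ N :=
          integral_mono_of_nonneg (ae_of_all _ fun y => abs_nonneg _) hgi (ae_of_all _ hpt)
      _ = 2 * (μ N).real (B N) + δ / 8 := by
          rw [integral_add ((integrable_const (2 : ℝ)).indicator (hB N)) (integrable_const _),
            integral_indicator_const _ (hB N), integral_const, probReal_univ, smul_eq_mul,
            smul_eq_mul, mul_comm, one_mul]
      _ ≤ δ / 8 + 2 * r N := by linarith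
  -- eventually `2 r_N ≤ δ / 8`
  have hev : ∀ᶠ N : ℕ in atTop, 2 * r N ≤ δ / 8 := by
    have ht : Tendsto (fun N => 2 * r N) atTop (𝓝 (2 * 0)) :=
      (tendsto_const_mul_exp_neg_succ C₁ hC₁).const_mul 2
    rw [mul_zero] at ht
    exact ht.eventually (ge_mem_nhds (by positivity))
  obtain ⟨N₀, hN₀⟩ := eventually_atTop.1 hev
  -- the constant
  have hC₃ : 0 < C₁ + C₂ := add_pos hC₁ hC₂
  set C' : ℝ := max (C₁ + C₂) (max (N₀ : ℝ) 3) with hC'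
  have hCC' : C₁ + C₂ ≤ C' := le_max_left _ _
  have hC'3 : (3 : ℝ) ≤ C' := (le_max_right _ _).trans (le_max_right _ _)
  have hC'N₀ : (N₀ : ℝ) ≤ C' := (le_max_left _ _).trans (le_max_right _ _)
  have hC'pos : 0 < C' := hC₃.trans_le hCC'
  refine ⟨C', hC'pos, fun N => ?_⟩
  haveI := hμ N
  by_cases hN : N₀ ≤ N
  · -- large `N`: the event is inside `B_N ∪ {δ/2 < |G' − mean'|}`
    have hsub : {x | δ < |G N x - ∫ y, G N y ∂μ N|} ⊆
        B N ∪ {x | δ / 2 < |G' N x - ∫ y, G' N y ∂μ N|} := by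
      intro x hx
      simp only [mem_setOf_eq, mem_union] at hx ⊢
      by_contra hcon
      rw [not_or, not_lt] at hcon
      have h1 := hnear N x hcon.1
      have hm := hmean N
      have h2 := hN₀ N hN
      have htri : |G N x - ∫ y, G N y ∂μ N| ≤ |G N x - G' N x| +
          |G' N x - ∫ y, G' N y ∂μ N| + |(∫ y, G' N y ∂μ N) - ∫ y, G N y ∂μ N| := by
        have e : G N x - ∫ y, G N y ∂μ N = (G N x - G' N x) +
            (G' N x - ∫ y, G' N y ∂μ N) + ((∫ y, G' N y ∂μ N) - ∫ y, G N y ∂μ N) := by ring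
        rw [e]
        exact (abs_add_le _ _).trans (add_le_add (abs_add_le _ _) le_rfl)
      rw [abs_sub_comm (∫ y, G' N y ∂μ N)] at htri
      linarith [hcon.2]
    calc μ N {x | δ < |G N x - ∫ y, G N y ∂μ N|}
        ≤ μ N (B N) + μ N {x | δ / 2 < |G' N x - ∫ y, G' N y ∂μ N|} :=
          (measure_mono hsub).trans (measure_union_le _ _)
      _ ≤ ENNReal.ofReal (C₁ * Real.exp (-(C₁⁻¹ * ((N : ℝ) + 1)))) +
            ENNReal.ofReal (C₂ * Real.exp (-(C₂⁻¹ * ((N : ℝ) + 1)))) :=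
          add_le_add (hBμ N) (hG'c N)
      _ ≤ ENNReal.ofReal ((C₁ + C₂) * Real.exp (-((C₁ + C₂)⁻¹ * ((N : ℝ) + 1)))) :=
          UniformLGC.ofReal_Kexp_add_le hC₁ hC₂ (by positivity)
      _ ≤ ENNReal.ofReal (C' * Real.exp (-(C'⁻¹ * ((N : ℝ) + 1)))) :=
          ENNReal.ofReal_le_ofReal (UniformLGC.Kexp_le_Kexp hC₃ hCC' (by positivity))
  · -- small `N`: the bound is at least `1`
    have hN' : (N : ℝ) + 1 ≤ N₀ := by exact_mod_cast Nat.lt_of_not_le hN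
    have hexp : Real.exp (-1) ≤ Real.exp (-(C'⁻¹ * ((N : ℝ) + 1))) := by
      refine Real.exp_le_exp.2 ?_
      have h1 : C'⁻¹ * ((N : ℝ) + 1) ≤ C'⁻¹ * C' :=
        mul_le_mul_of_nonneg_left (hN'.trans hC'N₀) (inv_nonneg.2 hC'pos.le)
      rw [inv_mul_cancel₀ hC'pos.ne'] at h1
      linarith
    have he : (1 : ℝ) ≤ 3 * Real.exp (-1) := by
      have := Real.exp_one_lt_d9
      have h1 : Real.exp (-1) = (Real.exp 1)⁻¹ := Real.exp_neg 1
      rw [h1, ← div_eq_mul_inv, le_div_iff₀ (Real.exp_pos 1)]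
      linarith
    have hone : (1 : ℝ) ≤ C' * Real.exp (-(C'⁻¹ * ((N : ℝ) + 1))) := by
      calc (1 : ℝ) ≤ 3 * Real.exp (-1) := he
        _ ≤ C' * Real.exp (-(C'⁻¹ * ((N : ℝ) + 1))) :=
            mul_le_mul hC'3 hexp (Real.exp_pos _).le hC'pos.le
    calc μ N {x | δ < |G N x - ∫ y, G N y ∂μ N|} ≤ 1 := prob_le_one
      _ ≤ ENNReal.ofReal (C' * Real.exp (-(C'⁻¹ * ((N : ℝ) + 1)))) :=
          ENNReal.one_le_ofReal.2 hone

/-! ### Plumbing: the kinetic energy per particle along `Λ` -/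

/-- **The kinetic energy per particle does not increase along the Lambertian flow**:
`e_1(Λ_t(z, ξ)) ≤ e_1(z)` (`empiricalEnergyField_one_eq`: `e_1 = (N+1)⁻¹ · configEnergy`, and
`configEnergy_lambertFlow_le`). [folklore] -/
theorem empiricalEnergyField_one_lambertFlow_le {N : ℕ} (ε : ℝ) (ξs : ℕ → EuclideanSpace ℝ (Fin 3))
    (z : Config (N + 1) (Fin 3) T3) (t : ℝ) :
    empiricalEnergyField (lambertFlow (Torus.geometry (Fin 3)) ε ξs z t) (fun _ => 1) ≤
      empiricalEnergyField z (fun _ => 1) := by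
  rw [empiricalEnergyField_one_eq, empiricalEnergyField_one_eq]
  exact mul_le_mul_of_nonneg_left (configEnergy_lambertFlow_le _ _ _) (by positivity)

/-! ### T7: smooth test functions suffice on the `Λ`-side -/

/-- **T7 · SMOOTH TEST FUNCTIONS SUFFICE ON THE Λ-SIDE** (`stub_fieldConcentration_of_smoothTest`,
registered stub of line `Sketch` of stmt-AtomisticToContinuum-11850): the Λ-side research stub S2 —
speed-`N` self-averaging of every bounded `1`-Lipschitz statistic `F` of the `χ`-tested field triple
of the Lambertian gas about its own `P_N ⊗ γ^ℕ`-mean, for all continuous `χ` — follows from its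
restriction to test functions `χ` with smooth periodic lift (`Torus.IsSmooth χ`). Given continuous
`χ`, `F`, `δ`: pick a smooth `ψ` with `‖χ − ψ‖_∞ ≤ δ' := δ / (8 (1 + K))` (`exists_isSmooth_near`),
where `K := |∫ E(ρ₀, u₀, θ₀)| + 1` bounds the kinetic energy per particle `e_1` off the energy event
`B_N := {1 < |e_1(p.1) − ∫ E₀|}`, of `P_N ⊗ γ^ℕ`-measure `≤ C₁ e^{−(N+1)/C₁}`
(`uniformLocalGibbsConcentration_proof`, stmt-14445, with `χ ≡ 1`; its density guard holds for
`σ ≤ min 1 (η₀ ∫a₀ / sup a₀)`); along `Λ` the kinetic energy does not increase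
(`configEnergy_lambertFlow_le`), so off `B_N` the `χ`- and `ψ`-field triples of `Λ_t p` are
`δ'(1 + K) = δ/8`-close in the sup distance (`empiricalFields_sub_le`), hence so are `F` of them;
conclude with the bookkeeping lemma `expConc_sub_integral_of_near` and the hypothesis at
`(ψ, F, δ/2)`. `σ₀ := min (1/2) (min σ₁ σ₂)`. [folklore] -/
theorem stub_fieldConcentration_of_smoothTest
    (hsm :
    ∀ (a₀ θ₀ : T3 → ℝ) (u₀ : T3 → V3), Continuous a₀ → Continuous θ₀ → Continuous u₀ →
      (∀ x, 0 < a₀ x) → (∀ x, 0 < θ₀ x) →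
      ∃ σ₀ : ℝ, 0 < σ₀ ∧ ∀ σ : ℝ, 0 < σ → σ < σ₀ →
        ∀ (T : ℝ) (ρ θ : ℝ → T3 → ℝ) (u : ℝ → T3 → V3), IsHardSphereEulerSolution σ T ρ u θ →
          ∀ Φ : (N : ℕ) → HardSphereFlow (Torus.geometry (Fin 3)) (hsDiameter σ N) (N + 1),
            TendstoHydroFieldsAt (fun N => localGibbsLaw σ a₀ u₀ θ₀ N (Φ N)) Φ ρ u θ 0 →
              ∀ t ∈ Set.Ico 0 T, ∀ χ : T3 → ℝ, Literature.Analysis.FunctionSpaces.Torus.IsSmooth χ →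
                ∀ F : ℝ × V3 × ℝ → ℝ, LipschitzWith 1 F → (∀ y, |F y| ≤ 1) → ∀ δ : ℝ, 0 < δ →
                  ∃ C : ℝ, 0 < C ∧ ∀ N : ℕ,
                    ((localGibbsLaw σ a₀ u₀ θ₀ N (Φ N)).prod (lambertNoise (Fin 3)))
                      {p | δ < |F (empiricalDensityField
                              (lambertFlow (Torus.geometry (Fin 3)) (hsDiameter σ N) p.2 p.1 t) χ,
                            empiricalMomentumField
                              (lambertFlow (Torus.geometry (Fin 3)) (hsDiameter σ N) p.2 p.1 t) χ,
                            empiricalEnergyField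
                              (lambertFlow (Torus.geometry (Fin 3)) (hsDiameter σ N) p.2 p.1 t) χ) -
                          ∫ q, F (empiricalDensityField
                              (lambertFlow (Torus.geometry (Fin 3)) (hsDiameter σ N) q.2 q.1 t) χ,
                            empiricalMomentumField
                              (lambertFlow (Torus.geometry (Fin 3)) (hsDiameter σ N) q.2 q.1 t) χ,
                            empiricalEnergyField
                              (lambertFlow (Torus.geometry (Fin 3)) (hsDiameter σ N) q.2 q.1 t) χ)
                            ∂((localGibbsLaw σ a₀ u₀ θ₀ N (Φ N)).prod (lambertNoise (Fin 3)))|} ≤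
                      ENNReal.ofReal (C * Real.exp (-(C⁻¹ * ((N : ℝ) + 1))))) :
    ∀ (a₀ θ₀ : T3 → ℝ) (u₀ : T3 → V3), Continuous a₀ → Continuous θ₀ → Continuous u₀ →
      (∀ x, 0 < a₀ x) → (∀ x, 0 < θ₀ x) →
      ∃ σ₀ : ℝ, 0 < σ₀ ∧ ∀ σ : ℝ, 0 < σ → σ < σ₀ →
        ∀ (T : ℝ) (ρ θ : ℝ → T3 → ℝ) (u : ℝ → T3 → V3), IsHardSphereEulerSolution σ T ρ u θ →
          ∀ Φ : (N : ℕ) → HardSphereFlow (Torus.geometry (Fin 3)) (hsDiameter σ N) (N + 1),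
            TendstoHydroFieldsAt (fun N => localGibbsLaw σ a₀ u₀ θ₀ N (Φ N)) Φ ρ u θ 0 →
              ∀ t ∈ Set.Ico 0 T, ∀ χ : T3 → ℝ, Continuous χ →
                ∀ F : ℝ × V3 × ℝ → ℝ, LipschitzWith 1 F → (∀ y, |F y| ≤ 1) → ∀ δ : ℝ, 0 < δ →
                  ∃ C : ℝ, 0 < C ∧ ∀ N : ℕ,
                    ((localGibbsLaw σ a₀ u₀ θ₀ N (Φ N)).prod (lambertNoise (Fin 3)))
                      {p | δ < |F (empiricalDensityField
                              (lambertFlow (Torus.geometry (Fin 3)) (hsDiameter σ N) p.2 p.1 t) χ,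
                            empiricalMomentumField
                              (lambertFlow (Torus.geometry (Fin 3)) (hsDiameter σ N) p.2 p.1 t) χ,
                            empiricalEnergyField
                              (lambertFlow (Torus.geometry (Fin 3)) (hsDiameter σ N) p.2 p.1 t) χ) -
                          ∫ q, F (empiricalDensityField
                              (lambertFlow (Torus.geometry (Fin 3)) (hsDiameter σ N) q.2 q.1 t) χ,
                            empiricalMomentumField
                              (lambertFlow (Torus.geometry (Fin 3)) (hsDiameter σ N) q.2 q.1 t) χ,
                            empiricalEnergyField
                              (lambertFlow (Torus.geometry (Fin 3)) (hsDiameter σ N) q.2 q.1 t) χ)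
                            ∂((localGibbsLaw σ a₀ u₀ θ₀ N (Φ N)).prod (lambertNoise (Fin 3)))|} ≤
                      ENNReal.ofReal (C * Real.exp (-(C⁻¹ * ((N : ℝ) + 1)))) := by
  obtain ⟨η₀, hη₀, hU⟩ := uniformLocalGibbsConcentration_proof
  intro a₀ θ₀ u₀ ha hθ hu ha0 hθ0
  obtain ⟨σ₁, hσ₁, h1⟩ := hsm a₀ θ₀ u₀ ha hθ hu ha0 hθ0
  -- the density guard of `uniformLocalGibbsConcentration_proof` (as for rung R0)
  have hbdd : BddAbove (Set.range a₀) := (isCompact_range ha).bddAbove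
  have hsup_ge : ∀ x, a₀ x ≤ ⨆ y, a₀ y := fun x => le_ciSup hbdd x
  have hS : 0 < ⨆ y, a₀ y := (ha0 0).trans_le (hsup_ge 0)
  have hI : 0 < ∫ y, a₀ y := integral_pos_of_continuous_pos ha ha0
  set σ₂ : ℝ := min 1 (η₀ * (∫ y, a₀ y) / ⨆ y, a₀ y) with hσ₂def
  have hσ₂ : 0 < σ₂ := lt_min one_pos (by positivity)
  refine ⟨min 2⁻¹ (min σ₁ σ₂), lt_min (by norm_num) (lt_min hσ₁ hσ₂), ?_⟩
  intro σ hσ hσlt T ρ θ u hE Φ h0 t ht χ hχ F hF hF1 δ hδ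
  have hσhalf : σ < 2⁻¹ := hσlt.trans_le (min_le_left _ _)
  have hσσ₁ : σ < σ₁ := (hσlt.trans_le (min_le_right _ _)).trans_le (min_le_left _ _)
  have hσσ₂ : σ < σ₂ := (hσlt.trans_le (min_le_right _ _)).trans_le (min_le_right _ _)
  have hσ1 : σ ≤ 1 := hσσ₂.le.trans (min_le_left _ _)
  have hσq : σ ≤ η₀ * (∫ y, a₀ y) / ⨆ y, a₀ y := hσσ₂.le.trans (min_le_right _ _)
  have hguard : σ ^ 3 * (⨆ y, a₀ y) ≤ η₀ * ∫ y, a₀ y := by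
    have h3 : σ ^ 3 ≤ σ := by
      have := pow_le_pow_of_le_one hσ.le hσ1 (by norm_num : 1 ≤ 3)
      simpa using this
    calc σ ^ 3 * (⨆ y, a₀ y) ≤ σ * ⨆ y, a₀ y := mul_le_mul_of_nonneg_right h3 hS.le
      _ ≤ (η₀ * (∫ y, a₀ y) / ⨆ y, a₀ y) * ⨆ y, a₀ y := mul_le_mul_of_nonneg_right hσq hS.le
      _ = η₀ * ∫ y, a₀ y := div_mul_cancel₀ _ hS.ne'
  obtain ⟨ρ₀, -, -, hP, hconc⟩ := hU a₀ θ₀ u₀ ha hθ hu ha0 hθ0 σ hσ hguard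
  -- ENERGY EVENT: `χ ≡ 1` at level `1`
  obtain ⟨C₁, hC₁, hC₁N⟩ := hconc (fun _ => (1 : ℝ)) continuous_const 1 one_pos
  set Ebar : ℝ := ∫ x, (1 : ℝ) * totalEnergyDensity (ρ₀ x) (u₀ x) (θ₀ x) with hEbar
  set K : ℝ := |Ebar| + 1 with hK
  have hK0 : 0 ≤ K := by positivity
  have h1K : 0 < 1 + K := by positivity
  -- APPROXIMATION by a smooth test function
  set δ' : ℝ := δ / 8 / (1 + K) with hδ'
  have hδ'pos : 0 < δ' := by positivity
  have hδ'K : δ' * (1 + K) = δ / 8 := div_mul_cancel₀ _ h1K.ne'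
  obtain ⟨ψ, hψs, hψ⟩ := exists_isSmooth_near hχ hδ'pos
  obtain ⟨C₂, hC₂, hC₂N⟩ :=
    h1 σ hσ hσσ₁ T ρ θ u hE Φ h0 t ht ψ hψs F hF hF1 (δ / 2) (half_pos hδ)
  -- notation
  set Q : (N : ℕ) → Measure (Config (N + 1) (Fin 3) T3 × (ℕ → EuclideanSpace ℝ (Fin 3))) :=
    fun N => (localGibbsLaw σ a₀ u₀ θ₀ N (Φ N)).prod (lambertNoise (Fin 3)) with hQ
  have hQN : ∀ N, IsProbabilityMeasure (Q N) := fun N => by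
    haveI := hP N (Φ N)
    rw [hQ]
    infer_instance
  set fld : (T3 → ℝ) → (N : ℕ) → Config (N + 1) (Fin 3) T3 × (ℕ → EuclideanSpace ℝ (Fin 3)) →
      ℝ × V3 × ℝ :=
    fun χ' N p =>
      (empiricalDensityField (lambertFlow (Torus.geometry (Fin 3)) (hsDiameter σ N) p.2 p.1 t) χ',
        empiricalMomentumField (lambertFlow (Torus.geometry (Fin 3)) (hsDiameter σ N) p.2 p.1 t) χ',
        empiricalEnergyField (lambertFlow (Torus.geometry (Fin 3)) (hsDiameter σ N) p.2 p.1 t) χ')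
    with hfld
  have hfldm : ∀ {χ' : T3 → ℝ}, Continuous χ' → ∀ N, Measurable (fld χ' N) := fun hχ' N =>
    (measurable_fieldTriple hχ').comp (measurable_lambertFlow_hsDiameter hσ.le hσhalf N t)
  -- the energy event under `Q N`
  set B : (N : ℕ) → Set (Config (N + 1) (Fin 3) T3 × (ℕ → EuclideanSpace ℝ (Fin 3))) :=
    fun N => {p | 1 < |empiricalEnergyField p.1 (fun _ => 1) - Ebar|} with hB
  have hBm : ∀ N, MeasurableSet (B N) := fun N =>
    measurableSet_lt measurable_const
      (((measurable_empiricalEnergyField continuous_const).comp measurable_fst).sub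
        measurable_const).abs
  have hBQ : ∀ N, Q N (B N) ≤ ENNReal.ofReal (C₁ * Real.exp (-(C₁⁻¹ * ((N : ℝ) + 1)))) := by
    intro N
    haveI := hP N (Φ N)
    have hsub : B N ⊆
        {z : Config (N + 1) (Fin 3) T3 | 1 < |empiricalEnergyField z (fun _ => 1) - Ebar|} ×ˢ
          (univ : Set (ℕ → EuclideanSpace ℝ (Fin 3))) :=
      fun p hp => ⟨hp, mem_univ _⟩
    calc Q N (B N)
        ≤ Q N ({z : Config (N + 1) (Fin 3) T3 | 1 < |empiricalEnergyField z (fun _ => 1) - Ebar|} ×ˢ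
            (univ : Set (ℕ → EuclideanSpace ℝ (Fin 3)))) := measure_mono hsub
      _ ≤ localGibbsLaw σ a₀ u₀ θ₀ N (Φ N)
              {z | 1 < |empiricalEnergyField z (fun _ => 1) - Ebar|} *
            lambertNoise (Fin 3) (univ : Set (ℕ → EuclideanSpace ℝ (Fin 3))) :=
          Measure.prod_prod_le _ _
      _ = localGibbsLaw σ a₀ u₀ θ₀ N (Φ N)
              {z | 1 < |empiricalEnergyField z (fun _ => 1) - Ebar|} := by
          rw [measure_univ, mul_one]
      _ ≤ ENNReal.ofReal (C₁ * Real.exp (-(C₁⁻¹ * ((N : ℝ) + 1)))) := (hC₁N N (Φ N)).2.2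
  -- off the energy event, `F ∘ fld χ` and `F ∘ fld ψ` are `δ/8`-close
  have hnear : ∀ N p, p ∉ B N → |F (fld χ N p) - F (fld ψ N p)| ≤ δ / 8 := by
    intro N p hp
    have hp' : ¬ (1 < |empiricalEnergyField p.1 (fun _ => 1) - Ebar|) := hp
    have he1 : empiricalEnergyField p.1 (fun _ => 1) ≤ K := by
      have h1 := le_abs_self (empiricalEnergyField p.1 (fun _ => 1) - Ebar)
      have h2 := le_abs_self Ebar
      linarith [not_lt.1 hp']
    have hew : empiricalEnergyField (lambertFlow (Torus.geometry (Fin 3)) (hsDiameter σ N) p.2 p.1 t)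
        (fun _ => 1) ≤ K :=
      (empiricalEnergyField_one_lambertFlow_le _ _ _ _).trans he1
    obtain ⟨hd, hm, hen⟩ :=
      empiricalFields_sub_le (lambertFlow (Torus.geometry (Fin 3)) (hsDiameter σ N) p.2 p.1 t) hψ
    have hdist : dist (fld ψ N p) (fld χ N p) ≤ δ / 8 := by
      simp only [hfld]
      rw [Prod.dist_eq, Prod.dist_eq, Real.dist_eq, dist_eq_norm, Real.dist_eq]
      refine max_le ?_ (max_le ?_ ?_)
      · calc _ ≤ δ' := hd
          _ ≤ δ' * (1 + K) := le_mul_of_one_le_right hδ'pos.le (by linarith)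
          _ = δ / 8 := hδ'K
      · calc _ ≤ δ' * (1 / 2 + empiricalEnergyField
              (lambertFlow (Torus.geometry (Fin 3)) (hsDiameter σ N) p.2 p.1 t) (fun _ => 1)) := hm
          _ ≤ δ' * (1 + K) := mul_le_mul_of_nonneg_left (by linarith) hδ'pos.le
          _ = δ / 8 := hδ'K
      · calc _ ≤ δ' * empiricalEnergyField
              (lambertFlow (Torus.geometry (Fin 3)) (hsDiameter σ N) p.2 p.1 t) (fun _ => 1) := hen
          _ ≤ δ' * (1 + K) := mul_le_mul_of_nonneg_left (by linarith) hδ'pos.le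
          _ = δ / 8 := hδ'K
    have hL : dist (F (fld χ N p)) (F (fld ψ N p)) ≤ dist (fld χ N p) (fld ψ N p) := by
      simpa using hF.dist_le_mul (fld χ N p) (fld ψ N p)
    rw [Real.dist_eq] at hL
    rw [dist_comm] at hdist
    exact hL.trans hdist
  -- conclude by the abstract bookkeeping lemma
  have hmain := expConc_sub_integral_of_near Q hQN (fun N p => F (fld χ N p))
    (fun N p => F (fld ψ N p)) (fun N => hF.continuous.measurable.comp (hfldm hχ N))
    (fun N => hF.continuous.measurable.comp (hfldm hψs.continuous N)) (fun N p => hF1 _)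
    (fun N p => hF1 _) B hBm hδ hnear hC₁ hBQ hC₂
    (fun N => by simpa only [hfld, hQ] using hC₂N N)
  simpa only [hfld, hQ] using hmain

end Summit.AtomisticToContinuum.HydrodynamicLimit.Theorems
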